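import Summits.Ventures.HodgeRepro2.T5SU11ResolventTransformClass

/-!
# The transform of the resolvent against an eigenfunction of the kernel, and the ground-state coefficient

Row 520's Fubini argument, abstracted: if `w > 0` is continuous on `(0, ∞)`, `t ↦ K_λ(t, s) w(t) sinh 2t` is integrable
with `∫_{(0,∞)} K_λ(t, s) w(t) sinh 2t dt = κ w(s)` (an eigenfunction of the kernel, `κ ≤ 0`), and `g w sinh 2s` is
integrable on `(0, ∞)` for a source `g` of the class, then

**`∫_{(0,∞)} G^I_λ g · w sinh 2t dt = κ ∫_{(0,∞)} g w sinh 2s ds`** (`transform_greenSolI_of_eigen`).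

Applied to the ground state `w = Ξ = φ_1` with `κ = −1/(μ + 1)` (row 519) and a source of rate `ε > 1`:

**`∫_{(0,∞)} G^I_λ g · Ξ sinh 2t dt = −(∫_{(0,∞)} g Ξ sinh 2s ds)/(μ + 1)`** (`transform_greenSolI_one_eq`)

— the ground-state coefficient of the resolvent on the whole class, the spectral multiplier `−1/(λ − 1)²` of row 481
(`integrableOn_sph_one_mul_mul_sinh_Ioi`: `Ξ g sinh 2s` is integrable at any rate `ε > 1`). Nothing is claimed
about (N).

Blind lane: Mathlib + the HodgeRepro2 prefix only; no sorry; axioms ⊆ {propext, Classical.choice,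
Quot.sound}.
-/

namespace Summit.Ventures.HodgeRepro2.T5SU11ResolventTransformEdge

open Filter Topology MeasureTheory
open Set (Ioi Ioc Icc)
open T5SU11Cartan T5SU11SphericalFunction T5SU11SphericalBounds T5SU11SphericalContinuous
  T5SU11SphericalSolutionSpaceAll T5SU11SphericalDecay T5SU11RadialGreenKernel T5SU11RadialGreenPositivity
  T5SU11RadialGreenImproper T5SU11RadialGreenImproperDecaySource T5SU11ResolventKernelComposition
  T5SU11ResolventBoundaryEdge T5SU11ResolventDiagonalEdge T5SU11ResolventEigenfunction
  T5SU11ResolventTransformClass T5SU11ResolventWeightedBasis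

section measure

variable [MeasurableSpace Circle] [BorelSpace Circle]

variable {lam : ℝ} (hlam : 1 < lam)
  {g : ℝ → ℝ} (hg : ContinuousOn g (Ioi 0))
  {M : ℝ} (hM : ∀ s ∈ Ioc (0 : ℝ) 1, |g s| ≤ M) (hM0 : 0 ≤ M)
  {ε C s₀ : ℝ} (hε : 2 - lam < ε) (hC : ∀ s, s₀ ≤ s → |g s| ≤ C * Real.exp (-ε * s))
  {w : ℝ → ℝ} (hw : ContinuousOn w (Ioi 0)) (hw0 : ∀ t, 0 < t → 0 < w t) {κ : ℝ}
  (hwI : ∀ s, 0 < s → IntegrableOn (fun t => sphGreenKernel lam t s * w t * Real.sinh (2 * t)) (Ioi 0))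
  (hwK : ∀ s, 0 < s → ∫ t in Ioi 0, sphGreenKernel lam t s * w t * Real.sinh (2 * t) = κ * w s)
  (hgw : IntegrableOn (fun s => g s * w s * Real.sinh (2 * s)) (Ioi 0))

include hlam hg hw hw0 hwI hwK hgw in
/-- The product integrand `K_λ(t, s) g(s) sinh 2s · w(t) sinh 2t` is integrable on `(0, ∞) × (0, ∞)`. -/
theorem integrable_prod_kernel_of_eigen :
    Integrable (Function.uncurry fun t s => sphGreenKernel lam t s * g s * Real.sinh (2 * s)
        * (w t * Real.sinh (2 * t)))
      ((volume.restrict (Ioi 0)).prod (volume.restrict (Ioi 0))) := by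
  have hχ : ContinuousOn (sphDecay lam) (Ioi 0) :=
    fun _ hr => (hasDerivAt_sphDecay hlam hr).continuousAt.continuousWithinAt
  have hmeas : AEStronglyMeasurable (Function.uncurry fun t s => sphGreenKernel lam t s * g s * Real.sinh (2 * s)
      * (w t * Real.sinh (2 * t))) ((volume.restrict (Ioi 0)).prod (volume.restrict (Ioi 0))) := by
    rw [Measure.prod_restrict]
    refine ContinuousOn.aestronglyMeasurable ?_ (measurableSet_Ioi.prod measurableSet_Ioi)
    have hK : ContinuousOn (fun p : ℝ × ℝ => sphGreenKernel lam p.1 p.2) (Ioi 0 ×ˢ Ioi 0) := by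
      simp only [sphGreenKernel, greenKernel]
      apply ContinuousOn.neg
      apply ContinuousOn.mul
      · exact ((continuous_sph_hyp lam).comp (continuous_fst.min continuous_snd)).continuousOn
      · exact hχ.comp (continuous_fst.max continuous_snd).continuousOn
          (fun p hp => Set.mem_Ioi.mpr (lt_of_lt_of_le (Set.mem_Ioi.mp hp.1) (le_max_left _ _)))
    have hg' : ContinuousOn (fun p : ℝ × ℝ => g p.2) (Ioi 0 ×ˢ Ioi 0) :=
      hg.comp continuous_snd.continuousOn (fun p hp => hp.2)
    have hw' : ContinuousOn (fun p : ℝ × ℝ => w p.1) (Ioi 0 ×ˢ Ioi 0) :=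
      hw.comp continuous_fst.continuousOn (fun p hp => hp.1)
    exact ((hK.mul hg').mul
      (Real.continuous_sinh.comp (continuous_const.mul continuous_snd)).continuousOn).mul
      (hw'.mul (Real.continuous_sinh.comp (continuous_const.mul continuous_fst)).continuousOn)
  rw [integrable_prod_iff' hmeas]
  refine ⟨?_, ?_⟩
  · refine (ae_restrict_iff' measurableSet_Ioi).mpr (Eventually.of_forall fun s hs => ?_)
    have hs0 : 0 < s := hs
    have h := (hwI s hs0).mul_const (g s * Real.sinh (2 * s))
    refine h.congr (Eventually.of_forall fun t => ?_)
    simp only [Function.uncurry_apply_pair]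
    ring
  · have hI := hgw.abs.mul_const (-κ)
    refine hI.congr ?_
    refine (ae_restrict_iff' measurableSet_Ioi).mpr (Eventually.of_forall fun s hs => ?_)
    have hs0 : 0 < s := hs
    have hsinh : 0 ≤ Real.sinh (2 * s) := Real.sinh_nonneg_iff.mpr (by linarith)
    have e : ∀ t, ‖Function.uncurry (fun t s => sphGreenKernel lam t s * g s * Real.sinh (2 * s)
        * (w t * Real.sinh (2 * t))) (t, s)‖
        = |sphGreenKernel lam t s * w t * Real.sinh (2 * t)| * (|g s| * Real.sinh (2 * s)) := by
      intro t
      simp only [Function.uncurry_apply_pair, Real.norm_eq_abs]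
      rw [show sphGreenKernel lam t s * g s * Real.sinh (2 * s) * (w t * Real.sinh (2 * t))
        = (sphGreenKernel lam t s * w t * Real.sinh (2 * t)) * (g s * Real.sinh (2 * s)) by ring,
        abs_mul, abs_mul (g s), abs_of_nonneg hsinh]
    -- `∫_t |K w sinh| = −κ w(s)` since the kernel is negative
    have habs : ∫ t in Ioi 0, |sphGreenKernel lam t s * w t * Real.sinh (2 * t)| = -(κ * w s) := by
      rw [← hwK s hs0, ← MeasureTheory.integral_neg]
      apply setIntegral_congr_fun measurableSet_Ioi
      intro t ht
      have ht0 : 0 < t := ht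
      have hK : sphGreenKernel lam t s ≤ 0 := (sphGreenKernel_neg hlam ht0).le
      have hsinh' : 0 ≤ Real.sinh (2 * t) := Real.sinh_nonneg_iff.mpr (by linarith)
      simp only
      rw [abs_of_nonpos (mul_nonpos_of_nonpos_of_nonneg (mul_nonpos_of_nonpos_of_nonneg hK (hw0 t ht0).le) hsinh')]
    simp only [e]
    rw [MeasureTheory.integral_mul_const, habs, abs_mul, abs_mul, abs_of_pos (hw0 s hs0), abs_of_nonneg hsinh]
    ring

include hlam hg hM hM0 hε hC hw hw0 hwI hwK hgw in
/-- **The transform of the resolvent against an eigenfunction of the kernel**: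
`∫_{(0,∞)} G^I_λ g · w sinh 2t dt = κ ∫_{(0,∞)} g w sinh 2s ds`. -/
theorem transform_greenSolI_of_eigen :
    ∫ t in Ioi 0, greenSolI (fun t => sph lam (hyp t)) (sphDecay lam) g t * w t * Real.sinh (2 * t)
      = κ * ∫ s in Ioi 0, g s * w s * Real.sinh (2 * s) := by
  have hF := integrable_prod_kernel_of_eigen hlam hg hw hw0 hwI hwK hgw
  have hswap := integral_integral_swap hF
  have hB := integrableOn_sph_mul_mul_sinh_Ioc hg hM hM0 lam
  have hA := integrableOn_sphDecay_mul_mul_sinh hlam hg hM hM0 hε hC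
  have hL : ∫ t in Ioi 0, ∫ s in Ioi 0, sphGreenKernel lam t s * g s * Real.sinh (2 * s) * (w t * Real.sinh (2 * t))
      = ∫ t in Ioi 0, greenSolI (fun t => sph lam (hyp t)) (sphDecay lam) g t * w t * Real.sinh (2 * t) := by
    apply setIntegral_congr_fun measurableSet_Ioi
    intro t ht
    have ht0 : 0 < t := ht
    simp only
    rw [MeasureTheory.integral_mul_const, greenSolI_eq_integral_kernel hB hA ht0]
    simp only [sphGreenKernel]
    ring
  have hR : ∫ s in Ioi 0, ∫ t in Ioi 0, sphGreenKernel lam t s * g s * Real.sinh (2 * s) * (w t * Real.sinh (2 * t))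
      = ∫ s in Ioi 0, κ * (g s * w s * Real.sinh (2 * s)) := by
    apply setIntegral_congr_fun measurableSet_Ioi
    intro s hs
    have hs0 : 0 < s := hs
    simp only
    have e : ∀ t, sphGreenKernel lam t s * g s * Real.sinh (2 * s) * (w t * Real.sinh (2 * t))
        = sphGreenKernel lam t s * w t * Real.sinh (2 * t) * (g s * Real.sinh (2 * s)) := by
      intro t; ring
    simp only [e]
    rw [MeasureTheory.integral_mul_const, hwK s hs0]
    ring
  rw [← hL, hswap, hR, MeasureTheory.integral_const_mul]

/-! ### The ground state -/

include hg hM hM0 hC in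
/-- **`Ξ g sinh 2s` is integrable on `(0, ∞)`** for a source of the class at a rate `ε > 1`. -/
theorem integrableOn_sph_one_mul_mul_sinh_Ioi (hε1 : 1 < ε) :
    IntegrableOn (fun s => g s * sph 1 (hyp s) * Real.sinh (2 * s)) (Ioi 0) := by
  have hC0 : 0 ≤ C := by
    have h := hC (max s₀ 0) (le_max_left _ _)
    have := abs_nonneg (g (max s₀ 0))
    have := Real.exp_pos (-ε * max s₀ 0)
    nlinarith
  -- `Ξ ≤ C₁ e^{−ε′ s}` with `ε′ ∈ (2 − ε, 1)`
  set ε' := (2 - ε + 1) / 2 with hε'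
  have hε'1 : ε' < 1 := by rw [hε']; linarith
  have hε'2 : 2 - ε < ε' := by rw [hε']; linarith
  obtain ⟨C₁, hC₁⟩ := exists_abs_sph_one_le_exp hε'1
  have hC₁0 : 0 ≤ C₁ := by
    have h := hC₁ 0 le_rfl
    have := abs_nonneg (sph 1 (hyp 0))
    have := Real.exp_pos (-ε' * 0)
    nlinarith
  set T := max s₀ 1 with hT
  have hsplit : Ioc 0 T ∪ Ioi T = Ioi 0 := Set.Ioc_union_Ioi_eq_Ioi (by linarith [le_max_right s₀ 1])
  have hI1 : IntegrableOn (fun s => g s * sph 1 (hyp s) * Real.sinh (2 * s)) (Ioc 0 T) := by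
    have := integrableOn_sph_mul_mul_sinh_Ioc hg hM hM0 1 T
    refine this.congr_fun ?_ measurableSet_Ioc
    intro s _
    simp only
    ring
  have hI2 : IntegrableOn (fun s => g s * sph 1 (hyp s) * Real.sinh (2 * s)) (Ioi T) := by
    have hcont : ContinuousOn (fun s => g s * sph 1 (hyp s) * Real.sinh (2 * s)) (Ioi T) :=
      ((hg.mul (continuous_sph_hyp 1).continuousOn).mul
        (Real.continuous_sinh.comp (continuous_const.mul continuous_id)).continuousOn).mono
        (Set.Ioi_subset_Ioi (by linarith [le_max_right s₀ 1]))
    have hdom : IntegrableOn (fun s => C * C₁ / 2 * Real.exp (-(ε + ε' - 2) * s)) (Ioi T) :=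
      (exp_neg_integrableOn_Ioi T (by linarith)).const_mul _
    refine Integrable.mono' hdom (hcont.aestronglyMeasurable measurableSet_Ioi) ?_
    refine (ae_restrict_iff' measurableSet_Ioi).mpr (Eventually.of_forall fun s hs => ?_)
    have hs0 : 0 < s := lt_of_le_of_lt (by linarith [le_max_right s₀ 1] : (0 : ℝ) ≤ T) hs
    have hsinh : 0 ≤ Real.sinh (2 * s) := Real.sinh_nonneg_iff.mpr (by linarith)
    rw [Real.norm_eq_abs, abs_mul, abs_mul, abs_of_pos (sph_hyp_pos 1 s), abs_of_nonneg hsinh]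
    have hE : Real.exp (-(ε + ε' - 2) * s) = Real.exp (-ε * s) * Real.exp (-ε' * s) * Real.exp (2 * s) := by
      rw [← Real.exp_add, ← Real.exp_add]; congr 1; ring
    rw [hE]
    have e1 := hC s (le_trans (le_max_left _ _) (le_of_lt hs))
    have e2 : sph 1 (hyp s) ≤ C₁ * Real.exp (-ε' * s) := by
      have := hC₁ s hs0.le
      rwa [abs_of_pos (sph_hyp_pos 1 s)] at this
    have e3 := sinh_le_exp_div_two (2 * s)
    calc |g s| * sph 1 (hyp s) * Real.sinh (2 * s)
        ≤ (C * Real.exp (-ε * s)) * (C₁ * Real.exp (-ε' * s)) * (Real.exp (2 * s) / 2) :=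
          mul_le_mul (mul_le_mul e1 e2 (sph_hyp_pos 1 s).le (by positivity)) e3 hsinh (by positivity)
      _ = C * C₁ / 2 * (Real.exp (-ε * s) * Real.exp (-ε' * s) * Real.exp (2 * s)) := by ring
  rw [← hsplit]
  exact hI1.union hI2

include hlam hg hM hM0 hC in
/-- **THE GROUND-STATE COEFFICIENT OF THE RESOLVENT ON THE CLASS**: for a source at a rate `ε > 1`,
`∫_{(0,∞)} G^I_λ g · Ξ sinh 2t dt = −(∫_{(0,∞)} g Ξ sinh 2s ds)/(μ + 1)` — the multiplier `−1/(λ − 1)²` of row 481. -/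
theorem transform_greenSolI_one_eq (hε1 : 1 < ε) :
    ∫ t in Ioi 0, greenSolI (fun t => sph lam (hyp t)) (sphDecay lam) g t * sph 1 (hyp t) * Real.sinh (2 * t)
      = -(∫ s in Ioi 0, g s * sph 1 (hyp s) * Real.sinh (2 * s)) / (lam * (lam - 2) + 1) := by
  have hε : 2 - lam < ε := by linarith
  -- the class data of `Ξ` for the kernel integrability and the eigenfunction identity
  obtain ⟨Φ, hΦ0, hΦ⟩ := exists_abs_sph_le_one 1
  set ε₁ := (3 - lam) / 2 with hε₁'
  have hε₁ : 2 - lam < ε₁ := by rw [hε₁']; linarith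
  have hε₁1 : ε₁ < 1 := by rw [hε₁']; linarith
  obtain ⟨C₁, hC₁⟩ := exists_abs_sph_one_le_exp hε₁1
  have hC₁' : ∀ s, (0 : ℝ) ≤ s → |sph 1 (hyp s)| ≤ C₁ * Real.exp (-ε₁ * s) := hC₁
  have hw : ContinuousOn (fun t => sph 1 (hyp t)) (Ioi 0) := (continuous_sph_hyp 1).continuousOn
  have hB := integrableOn_sph_mul_mul_sinh_Ioc hw hΦ hΦ0 lam
  have hA := integrableOn_sphDecay_mul_mul_sinh hlam hw hΦ hΦ0 hε₁ hC₁'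
  have hwI : ∀ s, 0 < s → IntegrableOn (fun t => sphGreenKernel lam t s * sph 1 (hyp t) * Real.sinh (2 * t))
      (Ioi 0) := by
    intro s hs
    have h := integrableOn_kernel_mul hB hA hs
    refine h.congr_fun ?_ measurableSet_Ioi
    intro t _
    simp only [sphGreenKernel]
    rw [greenKernel_symm]
  have hwK : ∀ s, 0 < s → ∫ t in Ioi 0, sphGreenKernel lam t s * sph 1 (hyp t) * Real.sinh (2 * t)
      = -(1 / (lam * (lam - 2) + 1)) * sph 1 (hyp s) := by
    intro s hs
    have h := greenSolI_sph_one_eq hlam hs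
    rw [greenSolI_eq_integral_kernel hB hA hs] at h
    have e : ∫ t in Ioi 0, sphGreenKernel lam t s * sph 1 (hyp t) * Real.sinh (2 * t)
        = ∫ t in Ioi 0, greenKernel (fun t => sph lam (hyp t)) (sphDecay lam) s t * sph 1 (hyp t) * Real.sinh (2 * t) := by
      apply MeasureTheory.integral_congr_ae
      refine Eventually.of_forall fun t => ?_
      simp only [sphGreenKernel]
      rw [greenKernel_symm]
    rw [e, h]
    ring
  have hgw := integrableOn_sph_one_mul_mul_sinh_Ioi hg hM hM0 hC hε1
  have h := transform_greenSolI_of_eigen hlam hg hM hM0 hε hC hw (fun t _ => sph_hyp_pos 1 t) hwI hwK hgw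
  rw [h]
  ring

end measure

end Summit.Ventures.HodgeRepro2.T5SU11ResolventTransformEdge
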